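import Summits.QuantumFields.BalabanUV.Beta.EriceFlowEnclosureB12AsPrintedHistoryContagionShiftFlowZeroSemigroupGellMannLow

/-!
# Beta / EriceFlowEnclosureB12AsPrintedHistoryContagionShiftFlowZeroSemigroupGellMannLowOneLoop — ASYMPTOTIC FREEDOM IS CONTAGIOUS, part 57: THE INFINITESIMAL
# GENERATOR OF THE FLOW WITH MEMORY IS ONE-LOOP UNIVERSAL — wherever the continuous renormalization group has a velocity, it is **`−(β₀∕2)·x³·(1 + O(x))`**, and it has
# one at almost every scale; NO differentiability hypothesis on the functional.  Parts 55–56 gave, for an abstract Λ with the chart bounds (2∕3, 4∕3), a velocity at a.e.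
# scale equal to `β₀∕Λ′` at the running coupling, of size `[−(3∕4)β₀x³, −(3∕8)β₀x³]`.  FOR THE FLOW (`B` with memory profile `(C_m, θ)` on ]0, γ]^ℕ, ONE AF reference, part
# 14's package at the reference pin e′, Λ ANY dynamical Abel function — part 44): (§90) the package alone gives **`κe′ ≤ 1∕3`**, `κ = 64C_m∕(3(1−θ)β*)`
# (`kappa_mul_le_third`), so part 44's asymptotic chart-isometry `|(Λ g − Λ g̃) − Δ| ≤ κg̃Δ` CONTAINS the chart bounds (2∕3, 4∕3) for EVERY dynamical Abel function
# (`dynAbel_chart_bounds` — parts 55–56 apply verbatim), and, read on left slopes at a differentiability point x, gives **`|(−x³∕2)·Λ′(x) − 1| ≤ κx`**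
# (**`hasDerivAt_dynAbel_oneLoop`**: the derivative of the Λ-coordinate, where it exists, is `−2∕x³` to relative precision κx — the infinitesimal form of the isometry);
# (§91) hence THE VELOCITY IS ONE-LOOP: wherever `s ↦ φ_s g` has a velocity V at the running coupling `x = φ_s g`,
# **`−(β₀∕2)x³∕(1 − κx) ≤ V ≤ −(β₀∕2)x³∕(1 + κx)`**, **`|(−2∕(β₀x³))·V − 1| ≤ (3∕2)κx`** (**`velocity_oneLoop`**), in the chart **`|∂_s(1∕φ_s(g)²) − β₀| ≤ (3∕2)β₀κx`**
# (`abs_chartVelocity_sub_le` — the continuous β-function in the chart is β₀ + O(x), the infinitesimal twin of part 33's `|β_eff(g) − β₀| ≤ 2C_m g∕(1−θ)` and of part 47's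
# integrated `sβ₀(1 ± κg)`); (§92) AT ALMOST EVERY COUPLING `Λ′(x) = −(2∕x³)(1 ± κx)` (`ae_hasDerivAt_dynAbel_oneLoop`), AT ALMOST EVERY SCALE the running coupling from
# every pin has the one-loop velocity (**`ae_velocity_oneLoop`**), and THE GENERATOR IS ASYMPTOTICALLY FREE: `(−2∕(β₀x³))·V → 1` uniformly as the running coupling
# `x → 0⁺` over all pins, scales and velocities (**`generator_asymptoticallyFree`**, ε–δ form).  In words: whatever the memory functional, the continuous RG near the
# Gaussian fixed point satisfies `ġ = −(β₀∕2)g³(1 + O(g))` in the only sense available without differentiating B — at almost every scale, and exactly wherever a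
# velocity exists at all.
# (β-flow team, prover 1 = recursion ∕ upper ∕ bare-coupling ∕ uniqueness side, unit `b2b-balaban-beta-bflow-p1`, gen 41; ROW AP-I·Uc × NODE U2 — the infinitesimal
# renormalization group, over parts 55–56 `…SemigroupVelocity` ∕ `…SemigroupGellMannLow` and part 44 `…ShiftFlowZeroIsometry` (`abs_dynAbel_sub_sub_chart_le`))

HONEST FRAMING (page 1 of everything the β sub-cell writes): discharging `BetaPertH` makes Bałaban's UV stability UNCONDITIONAL — a
real constructive-QFT result; it is NOT the continuum limit and NOT the Clay problem.  HONEST DEPENDENCY (cell reorg 2026-08-19,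
verbatim): «continuum YM on T⁴ ⇐ BetaPertH ∧ nine spine estimates (0/9 proved); BetaPertH ⇐ (D1) ∧ (D4) ∧ CAP+tail; G-an2-4 gates
asym, D1 and NE2/3/4.»  THIS MODULE DISCHARGES NOTHING: elementary real analysis over node U2's HYPOTHESIS SHAPES `T4BetaStationary.{SeqBox, MemoryProfile}`,
`T4BetaFlowWellPosed.{MemFlow, solution}` on an ABSTRACT functional `B`; parts 44 ∕ 54 ∕ 55 ∕ 56 BY NAME — nothing restated.  `ScaleShiftRate` (GAPS G-t4-U2-1),
`HistLipschitz`∕`FadingMemory` (G-t4-U2-2) and [I] THEOREM 2 (p. 259, STATED WITHOUT PROOF) do not occur in this abstract part (the carrier END is part 58); NOTHING is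
asserted about Bałaban's actual β: whether ITS limit functional has the printed `β₀ = 11∕(3(4π)²)·…` at the zero history is Erice's (3.73)∕(3.75) (pp. 249–250) read
for the limit — NOT PRINTED for the functional with memory ([I] p. 298).  «Velocity», «generator», «Gell-Mann–Low» are OUR READING.  [I] = T. Bałaban, Commun. Math. Phys.
**109** (1987) 249–301 [Balaban1987RG1].

WHAT THIS FILE PROVES (0 sorry, 0 def): §90 `kappa_mul_le_third`, **`dynAbel_chart_bounds`**, **`hasDerivAt_dynAbel_oneLoop`**; §91 **`velocity_oneLoop`**,
**`abs_chartVelocity_sub_le`**; §92 `ae_hasDerivAt_dynAbel_oneLoop`, **`ae_velocity_oneLoop`**, **`generator_asymptoticallyFree`**.  NOT CLAIMED: a velocity at EVERY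
scale; anything about Bałaban's β; `BetaPertH`; continuum; Clay.
-/

namespace Summit.QuantumFields.BalabanUV.Beta.EriceFlowEnclosureB12AsPrintedHistoryContagionShiftFlowZeroSemigroupGellMannLowOneLoop

open Filter Topology Set Function MeasureTheory
open Literature.MathematicalPhysics.QuantumFieldTheory.Balaban1983to89
open Literature.MathematicalPhysics.QuantumFieldTheory.Balaban1983to89.T4BetaStationary (SeqBox MemoryProfile)
open Literature.MathematicalPhysics.QuantumFieldTheory.Balaban1983to89.T4BetaFlowWellPosed (MemFlow solution)
open Summit.QuantumFields.BalabanUV.Beta.EriceFlowEnclosureB12AsPrintedHistoryContagionShiftFlowZeroIsometry (abs_dynAbel_sub_sub_chart_le)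
open Summit.QuantumFields.BalabanUV.Beta.EriceFlowEnclosureB12AsPrintedHistoryContagionShiftFlowZeroSemigroupBackward (rg_mem_eq_of_le)
open Summit.QuantumFields.BalabanUV.Beta.EriceFlowEnclosureB12AsPrintedHistoryContagionShiftFlowZeroSemigroupVelocity (hasDerivAt_chart_bounds_left
  ae_differentiableAt_abel ae_differentiableAt_rg)
open Summit.QuantumFields.BalabanUV.Beta.EriceFlowEnclosureB12AsPrintedHistoryContagionShiftFlowZeroSemigroupGellMannLow (hasDerivAt_abel_of_hasDerivAt_rg
  velocity_bounds hasDerivAt_rg_chart)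

noncomputable section

/-! ## §90 The package contains the chart bounds; the derivative of the Λ-coordinate, where it exists, is `−2∕x³·(1 ± κx)` -/

/-- **`κe′ ≤ 1∕3`** from part 14's package: `C_m(8e′³ + 16e′∕β*) ≤ (1 − θ)∕4` forces `(64C_m∕(3(1−θ)β*))·e′ ≤ 1∕3`. [folklore] -/
theorem kappa_mul_le_third {Cm θ bs e' : ℝ} (hCm : 0 ≤ Cm) (hθ1 : θ < 1) (hbs : 0 < bs) (he' : 0 ≤ e')
    (hs5 : Cm * (8 * e' ^ 3 + 16 * e' / bs) ≤ (1 - θ) / 4) : 64 * Cm / (3 * (1 - θ) * bs) * e' ≤ 1 / 3 := by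
  have h1θ : 0 < 1 - θ := by linarith
  have h1 : Cm * (16 * e' / bs) ≤ (1 - θ) / 4 := by
    have : 0 ≤ Cm * (8 * e' ^ 3) := by positivity
    nlinarith
  have h2 : 16 * Cm * e' ≤ (1 - θ) / 4 * bs := by
    have := h1; rw [show Cm * (16 * e' / bs) = 16 * Cm * e' / bs by ring, div_le_iff₀ hbs] at this; exact this
  rw [show 64 * Cm / (3 * (1 - θ) * bs) * e' = 64 * Cm * e' / (3 * (1 - θ) * bs) by ring, div_le_iff₀ (by positivity)]
  nlinarith

/-- **EVERY DYNAMICAL ABEL FUNCTION OBEYS THE CHART BOUNDS (2∕3, 4∕3)**: part 44's isometry `|(Λ g − Λ g̃) − Δ| ≤ κg̃Δ` with `κg̃ ≤ κe′ ≤ 1∕3` — so parts 55–56 apply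
verbatim to every dynamical Abel function of the flow near the zero pin. [cite: Balaban1987RG1, Thm 2 (0.31) p.259 with (0.18)–(0.20) pp.255–256] -/
theorem dynAbel_chart_bounds {B : (ℕ → ℝ) → ℝ} {Cm θ γ bs ta gs e' : ℝ} {t : ℕ → ℝ} {a : ℕ → ℝ} {Λ : ℝ → ℝ}
    (hB : MemoryProfile Cm θ γ B) (hCm : 0 ≤ Cm) (hθ0 : 0 ≤ θ) (hθ1 : θ < 1) (hbs : 0 < bs) (hta : 0 < ta)
    (hts : SeqBox γ t) (htf : MemFlow B gs t) (hprof : ∀ m : ℕ, 1 / ta ^ 2 + bs * (m : ℝ) ≤ 1 / (t m) ^ 2)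
    (hΛ : ∀ e ∈ Ioc (0 : ℝ) e', ∀ h : ℕ → ℝ, SeqBox γ h → MemFlow B e h → Tendsto (fun n => 1 / h n ^ 2 - a n) atTop (𝓝 (Λ e)))
    (h2e' : 2 * e' ≤ γ)
    (hs1 : 4 * Cm * e' ≤ bs * (1 - θ))
    (hs2 : e' ^ 2 * (1 / gs ^ 2 + Cm * γ / (1 - θ) ^ 2 + (2 * Cm / ((1 - θ) * bs)) ^ 2) ≤ 3 / 4)
    (hs4 : 64 * Cm * e' ^ 3 ≤ (1 - θ) ^ 2) (hs5 : Cm * (8 * e' ^ 3 + 16 * e' / bs) ≤ (1 - θ) / 4) :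
    ∀ e₁ ∈ Ioc (0 : ℝ) e', ∀ e₂ ∈ Ioc (0 : ℝ) e', e₁ ≤ e₂ →
      2 / 3 * (1 / e₁ ^ 2 - 1 / e₂ ^ 2) ≤ Λ e₁ - Λ e₂ ∧ Λ e₁ - Λ e₂ ≤ 4 / 3 * (1 / e₁ ^ 2 - 1 / e₂ ^ 2) := by
  intro e₁ h₁ e₂ h₂ h12
  have hiso := abs_dynAbel_sub_sub_chart_le hB hCm hθ0 hθ1 hbs hta hts htf hprof hΛ h2e' hs1 hs2 hs4 hs5 h₁.1 h12 h₂.2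
  have hκ := kappa_mul_le_third hCm hθ1 hbs (by linarith [h₂.1, h₂.2]) hs5
  have h1θ : 0 < 1 - θ := by linarith
  have hκ0 : 0 ≤ 64 * Cm / (3 * (1 - θ) * bs) := by positivity
  have hκe₂ : 64 * Cm / (3 * (1 - θ) * bs) * e₂ ≤ 1 / 3 := (mul_le_mul_of_nonneg_left h₂.2 hκ0).trans hκ
  have hΔ : 0 ≤ 1 / e₁ ^ 2 - 1 / e₂ ^ 2 := by
    have := h₁.1
    have : 1 / e₂ ^ 2 ≤ 1 / e₁ ^ 2 := one_div_le_one_div_of_le (by positivity) (by nlinarith)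
    linarith
  obtain ⟨hlo, hhi⟩ := abs_le.1 hiso
  have hprod : 64 * Cm / (3 * (1 - θ) * bs) * e₂ * (1 / e₁ ^ 2 - 1 / e₂ ^ 2) ≤ 1 / 3 * (1 / e₁ ^ 2 - 1 / e₂ ^ 2) :=
    mul_le_mul_of_nonneg_right hκe₂ hΔ
  constructor <;> linarith

/-- **THE DERIVATIVE OF THE Λ-COORDINATE, WHERE IT EXISTS, IS `−2∕x³` TO RELATIVE PRECISION κx**: for every dynamical Abel function Λ of the flow near the zero pin
and every interior coupling `x ∈ ]0, e′[` at which Λ has a derivative D: **`−(2∕x³)(1 + κx) ≤ D ≤ −(2∕x³)(1 − κx)`**, i.e. **`|(−x³∕2)·D − 1| ≤ κx`**,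
`κ = 64C_m∕(3(1−θ)β*)` — part 44's isometry read on the left slopes at x. [cite: Balaban1987RG1, Thm 2 (0.31) p.259 with (0.18)–(0.20) pp.255–256] -/
theorem hasDerivAt_dynAbel_oneLoop {B : (ℕ → ℝ) → ℝ} {Cm θ γ bs ta gs e' : ℝ} {t : ℕ → ℝ} {a : ℕ → ℝ} {Λ : ℝ → ℝ}
    (hB : MemoryProfile Cm θ γ B) (hCm : 0 ≤ Cm) (hθ0 : 0 ≤ θ) (hθ1 : θ < 1) (hbs : 0 < bs) (hta : 0 < ta)
    (hts : SeqBox γ t) (htf : MemFlow B gs t) (hprof : ∀ m : ℕ, 1 / ta ^ 2 + bs * (m : ℝ) ≤ 1 / (t m) ^ 2)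
    (hΛ : ∀ e ∈ Ioc (0 : ℝ) e', ∀ h : ℕ → ℝ, SeqBox γ h → MemFlow B e h → Tendsto (fun n => 1 / h n ^ 2 - a n) atTop (𝓝 (Λ e)))
    (h2e' : 2 * e' ≤ γ)
    (hs1 : 4 * Cm * e' ≤ bs * (1 - θ))
    (hs2 : e' ^ 2 * (1 / gs ^ 2 + Cm * γ / (1 - θ) ^ 2 + (2 * Cm / ((1 - θ) * bs)) ^ 2) ≤ 3 / 4)
    (hs4 : 64 * Cm * e' ^ 3 ≤ (1 - θ) ^ 2) (hs5 : Cm * (8 * e' ^ 3 + 16 * e' / bs) ≤ (1 - θ) / 4)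
    {x D : ℝ} (hx : x ∈ Ioo (0 : ℝ) e') (hD : HasDerivAt Λ D x) :
    -(2 / x ^ 3) * (1 + 64 * Cm / (3 * (1 - θ) * bs) * x) ≤ D ∧ D ≤ -(2 / x ^ 3) * (1 - 64 * Cm / (3 * (1 - θ) * bs) * x) ∧
      |-(x ^ 3) / 2 * D - 1| ≤ 64 * Cm / (3 * (1 - θ) * bs) * x := by
  set κ := 64 * Cm / (3 * (1 - θ) * bs) with hκdef
  have hratio : ∀ᶠ y in 𝓝[<] x, (1 - κ * x) * (1 / y ^ 2 - 1 / x ^ 2) ≤ Λ y - Λ x ∧ Λ y - Λ x ≤ (1 + κ * x) * (1 / y ^ 2 - 1 / x ^ 2) := by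
    filter_upwards [Ioo_mem_nhdsLT hx.1] with y hy
    have hiso := abs_dynAbel_sub_sub_chart_le hB hCm hθ0 hθ1 hbs hta hts htf hprof hΛ h2e' hs1 hs2 hs4 hs5 hy.1 hy.2.le hx.2.le
    obtain ⟨hlo, hhi⟩ := abs_le.1 hiso
    constructor <;> linarith
  obtain ⟨h1, h2⟩ := hasDerivAt_chart_bounds_left hx.1 hD hratio
  have hx3 : 0 < x ^ 3 := pow_pos hx.1 3
  refine ⟨?_, ?_, ?_⟩
  · calc -(2 / x ^ 3) * (1 + κ * x) = -2 * (1 + κ * x) / x ^ 3 := by ring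
      _ ≤ D := h1
  · calc D ≤ -2 * (1 - κ * x) / x ^ 3 := h2
      _ = -(2 / x ^ 3) * (1 - κ * x) := by ring
  · rw [abs_le]
    constructor
    · -- `D ≤ −2(1−κx)∕x³` ⟹ `(−x³∕2)D ≥ 1 − κx`
      have : -(x ^ 3) / 2 * D ≥ 1 - κ * x := by
        have hh : D * x ^ 3 ≤ -2 * (1 - κ * x) := by
          have := h2; rwa [le_div_iff₀ hx3] at this
        nlinarith
      linarith
    · have : -(x ^ 3) / 2 * D ≤ 1 + κ * x := by
        have hh : -2 * (1 + κ * x) ≤ D * x ^ 3 := by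
          have := h1; rwa [div_le_iff₀ hx3] at this
        nlinarith
      linarith

/-! ## §91 The velocity, where it exists, is one-loop -/

/-- **THE VELOCITY OF THE CONTINUOUS RENORMALIZATION GROUP IS ONE-LOOP.**  `B` with memory profile `(C_m, θ)` on ]0, γ]^ℕ; ONE AF reference t; part 14's package at the
reference pin e′; Λ ANY dynamical Abel function, strictly antitone on ]0, e′] onto `[Λ e′, ∞[`; β₀ > 0; a pin g and a real time s with `Λ e′ < Λ g + sβ₀`, and suppose the
running coupling `s ↦ φ_s g` HAS a velocity V at s (it does at a.e. s, part 55), `x = φ_s g`.  THEN, with `κ = 64C_m∕(3(1−θ)β*)` (`κx ≤ 1∕3`):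
**`−(β₀∕2)x³∕(1 − κx) ≤ V ≤ −(β₀∕2)x³∕(1 + κx)`** and **`|(−2∕(β₀x³))·V − 1| ≤ (3∕2)κx`** — the velocity is the one-loop β-function `−(β₀∕2)x³` to relative
precision O(x), whatever the memory functional. [cite: Balaban1987RG1, Thm 2 (0.31) p.259 with (0.18)–(0.20) pp.255–256] -/
theorem velocity_oneLoop {B : (ℕ → ℝ) → ℝ} {Cm θ γ β₀ bs ta gs e' : ℝ} {t : ℕ → ℝ} {a : ℕ → ℝ} {Λ : ℝ → ℝ}
    (hB : MemoryProfile Cm θ γ B) (hCm : 0 ≤ Cm) (hθ0 : 0 ≤ θ) (hθ1 : θ < 1) (hbs : 0 < bs) (hta : 0 < ta)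
    (hts : SeqBox γ t) (htf : MemFlow B gs t) (hprof : ∀ m : ℕ, 1 / ta ^ 2 + bs * (m : ℝ) ≤ 1 / (t m) ^ 2)
    (hΛ : ∀ e ∈ Ioc (0 : ℝ) e', ∀ h : ℕ → ℝ, SeqBox γ h → MemFlow B e h → Tendsto (fun n => 1 / h n ^ 2 - a n) atTop (𝓝 (Λ e)))
    (hanti : StrictAntiOn Λ (Ioc 0 e')) (honto : ∀ y : ℝ, Λ e' ≤ y → ∃ x ∈ Ioc (0 : ℝ) e', Λ x = y) (hβ₀ : 0 < β₀)
    (h2e' : 2 * e' ≤ γ)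
    (hs1 : 4 * Cm * e' ≤ bs * (1 - θ))
    (hs2 : e' ^ 2 * (1 / gs ^ 2 + Cm * γ / (1 - θ) ^ 2 + (2 * Cm / ((1 - θ) * bs)) ^ 2) ≤ 3 / 4)
    (hs4 : 64 * Cm * e' ^ 3 ≤ (1 - θ) ^ 2) (hs5 : Cm * (8 * e' ^ 3 + 16 * e' / bs) ≤ (1 - θ) / 4)
    {g s V : ℝ} (hgs : Λ e' < Λ g + s * β₀) (hV : HasDerivAt (fun σ : ℝ => invFunOn Λ (Ioc 0 e') (Λ g + σ * β₀)) V s) :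
    -(β₀ / 2) * invFunOn Λ (Ioc 0 e') (Λ g + s * β₀) ^ 3 / (1 - 64 * Cm / (3 * (1 - θ) * bs) * invFunOn Λ (Ioc 0 e') (Λ g + s * β₀)) ≤ V ∧
      V ≤ -(β₀ / 2) * invFunOn Λ (Ioc 0 e') (Λ g + s * β₀) ^ 3 / (1 + 64 * Cm / (3 * (1 - θ) * bs) * invFunOn Λ (Ioc 0 e') (Λ g + s * β₀)) ∧
      |-2 / (β₀ * invFunOn Λ (Ioc 0 e') (Λ g + s * β₀) ^ 3) * V - 1| ≤ 3 / 2 * (64 * Cm / (3 * (1 - θ) * bs)) * invFunOn Λ (Ioc 0 e') (Λ g + s * β₀) := by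
  set κ := 64 * Cm / (3 * (1 - θ) * bs) with hκdef
  have hbounds := dynAbel_chart_bounds hB hCm hθ0 hθ1 hbs hta hts htf hprof hΛ h2e' hs1 hs2 hs4 hs5
  obtain ⟨hxmem, hΛx⟩ := rg_mem_eq_of_le honto hgs.le
  set x := invFunOn Λ (Ioc 0 e') (Λ g + s * β₀) with hxdef
  have hxlt : x < e' := by
    rcases hxmem.2.lt_or_eq with h | h
    · exact h
    · exfalso; rw [h] at hΛx; linarith
  have hx : x ∈ Ioo (0 : ℝ) e' := ⟨hxmem.1, hxlt⟩
  obtain ⟨hVne, hD⟩ := hasDerivAt_abel_of_hasDerivAt_rg hanti honto hβ₀ hbounds hgs hV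
  obtain ⟨-, -, hVneg⟩ := velocity_bounds hanti honto hβ₀ hbounds hgs hV
  obtain ⟨h1, h2, -⟩ := hasDerivAt_dynAbel_oneLoop hB hCm hθ0 hθ1 hbs hta hts htf hprof hΛ h2e' hs1 hs2 hs4 hs5 hx hD
  have h1θ : 0 < 1 - θ := by linarith
  have hκ0 : 0 ≤ κ := by positivity
  have hκx : κ * x ≤ 1 / 3 :=
    (mul_le_mul_of_nonneg_left hxmem.2 hκ0).trans (kappa_mul_le_third hCm hθ1 hbs (by linarith [hxmem.1, hxmem.2]) hs5)
  have hκx0 : 0 ≤ κ * x := mul_nonneg hκ0 hxmem.1.le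
  have hx3 : 0 < x ^ 3 := pow_pos hxmem.1 3
  have hm : 0 < 1 - κ * x := by linarith
  have hp : 0 < 1 + κ * x := by linarith
  -- with `w = −V > 0`: `(2∕x³)(1 − κx) ≤ β₀∕w ≤ (2∕x³)(1 + κx)`
  set w := -V with hwdef
  have hw : 0 < w := by rw [hwdef]; linarith
  have hDw : β₀ / V = -(β₀ / w) := by rw [hwdef, div_neg, neg_neg]
  rw [hDw] at h1 h2
  have hlo : 2 / x ^ 3 * (1 - κ * x) ≤ β₀ / w := by linarith
  have hhi : β₀ / w ≤ 2 / x ^ 3 * (1 + κ * x) := by linarith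
  -- clear denominators: `2(1 − κx)w ≤ β₀x³ ≤ 2(1 + κx)w`
  have e2 : 2 * (1 - κ * x) * w ≤ β₀ * x ^ 3 := by
    have h' : 2 / x ^ 3 * (1 - κ * x) * w ≤ β₀ := (le_div_iff₀ hw).1 hlo
    have h'' : 2 * (1 - κ * x) * w / x ^ 3 ≤ β₀ := by
      calc 2 * (1 - κ * x) * w / x ^ 3 = 2 / x ^ 3 * (1 - κ * x) * w := by ring
        _ ≤ β₀ := h'
    exact (div_le_iff₀ hx3).1 h''
  have e3 : β₀ * x ^ 3 ≤ 2 * (1 + κ * x) * w := by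
    have h' : β₀ ≤ 2 / x ^ 3 * (1 + κ * x) * w := (div_le_iff₀ hw).1 hhi
    have h'' : β₀ ≤ 2 * (1 + κ * x) * w / x ^ 3 := by
      calc β₀ ≤ 2 / x ^ 3 * (1 + κ * x) * w := h'
        _ = 2 * (1 + κ * x) * w / x ^ 3 := by ring
    exact (le_div_iff₀ hx3).1 h''
  have hw_le : w ≤ β₀ / 2 * x ^ 3 / (1 - κ * x) := by
    rw [le_div_iff₀ hm]; linarith
  have hw_ge : β₀ / 2 * x ^ 3 / (1 + κ * x) ≤ w := by
    rw [div_le_iff₀ hp]; linarith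
  refine ⟨?_, ?_, ?_⟩
  · rw [hwdef] at hw_le
    have : -(β₀ / 2) * x ^ 3 / (1 - κ * x) = -(β₀ / 2 * x ^ 3 / (1 - κ * x)) := by ring
    rw [this]; linarith
  · rw [hwdef] at hw_ge
    have : -(β₀ / 2) * x ^ 3 / (1 + κ * x) = -(β₀ / 2 * x ^ 3 / (1 + κ * x)) := by ring
    rw [this]; linarith
  · -- `r := (−2∕(β₀x³))·V = 2w∕(β₀x³)` satisfies `r(1 − κx) ≤ 1 ≤ r(1 + κx)`, `0 ≤ r ≤ 3∕2`
    set r := -2 / (β₀ * x ^ 3) * V with hrdef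
    have hr : r = 2 * w / (β₀ * x ^ 3) := by rw [hrdef, hwdef]; ring
    have hr0 : 0 ≤ r := by rw [hr]; positivity
    have hr1 : r * (1 - κ * x) ≤ 1 := by
      rw [hr, div_mul_eq_mul_div, div_le_one (by positivity)]; linarith
    have hr2 : 1 ≤ r * (1 + κ * x) := by
      rw [hr, div_mul_eq_mul_div, one_le_div (by positivity)]; linarith
    have hp1 : r * (κ * x) ≤ r * (1 / 3) := mul_le_mul_of_nonneg_left hκx hr0
    have hr32 : r ≤ 3 / 2 := by linarith
    have hp2 : r * (κ * x) ≤ 3 / 2 * (κ * x) := mul_le_mul_of_nonneg_right hr32 hκx0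
    rw [abs_le]
    constructor <;> linarith

/-- **THE CONTINUOUS β-FUNCTION IN THE CHART IS β₀ + O(x)**: in the setting of `velocity_oneLoop`, `s ↦ 1∕φ_s(g)²` has derivative `−2V∕x³` at s with
**`|−2V∕x³ − β₀| ≤ (3∕2)β₀κx`** — the infinitesimal twin of part 33's one-step `|β_eff(g) − β₀| ≤ 2C_m g∕(1−θ)` and of part 47's integrated `sβ₀(1 ± κg)`.
[cite: Balaban1987RG1, Thm 2 (0.31) p.259 with (0.18)–(0.20) pp.255–256] -/
theorem abs_chartVelocity_sub_le {B : (ℕ → ℝ) → ℝ} {Cm θ γ β₀ bs ta gs e' : ℝ} {t : ℕ → ℝ} {a : ℕ → ℝ} {Λ : ℝ → ℝ}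
    (hB : MemoryProfile Cm θ γ B) (hCm : 0 ≤ Cm) (hθ0 : 0 ≤ θ) (hθ1 : θ < 1) (hbs : 0 < bs) (hta : 0 < ta)
    (hts : SeqBox γ t) (htf : MemFlow B gs t) (hprof : ∀ m : ℕ, 1 / ta ^ 2 + bs * (m : ℝ) ≤ 1 / (t m) ^ 2)
    (hΛ : ∀ e ∈ Ioc (0 : ℝ) e', ∀ h : ℕ → ℝ, SeqBox γ h → MemFlow B e h → Tendsto (fun n => 1 / h n ^ 2 - a n) atTop (𝓝 (Λ e)))
    (hanti : StrictAntiOn Λ (Ioc 0 e')) (honto : ∀ y : ℝ, Λ e' ≤ y → ∃ x ∈ Ioc (0 : ℝ) e', Λ x = y) (hβ₀ : 0 < β₀)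
    (h2e' : 2 * e' ≤ γ)
    (hs1 : 4 * Cm * e' ≤ bs * (1 - θ))
    (hs2 : e' ^ 2 * (1 / gs ^ 2 + Cm * γ / (1 - θ) ^ 2 + (2 * Cm / ((1 - θ) * bs)) ^ 2) ≤ 3 / 4)
    (hs4 : 64 * Cm * e' ^ 3 ≤ (1 - θ) ^ 2) (hs5 : Cm * (8 * e' ^ 3 + 16 * e' / bs) ≤ (1 - θ) / 4)
    {g s V : ℝ} (hgs : Λ e' < Λ g + s * β₀) (hV : HasDerivAt (fun σ : ℝ => invFunOn Λ (Ioc 0 e') (Λ g + σ * β₀)) V s) :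
    HasDerivAt (fun σ : ℝ => 1 / invFunOn Λ (Ioc 0 e') (Λ g + σ * β₀) ^ 2) (-2 * V / invFunOn Λ (Ioc 0 e') (Λ g + s * β₀) ^ 3) s ∧
      |-2 * V / invFunOn Λ (Ioc 0 e') (Λ g + s * β₀) ^ 3 - β₀| ≤ 3 / 2 * β₀ * (64 * Cm / (3 * (1 - θ) * bs)) * invFunOn Λ (Ioc 0 e') (Λ g + s * β₀) := by
  have hbounds := dynAbel_chart_bounds hB hCm hθ0 hθ1 hbs hta hts htf hprof hΛ h2e' hs1 hs2 hs4 hs5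
  obtain ⟨hder, -, -⟩ := hasDerivAt_rg_chart hanti honto hβ₀ hbounds hgs hV
  obtain ⟨-, -, hrel⟩ := velocity_oneLoop hB hCm hθ0 hθ1 hbs hta hts htf hprof hΛ hanti honto hβ₀ h2e' hs1 hs2 hs4 hs5 hgs hV
  obtain ⟨hxmem, -⟩ := rg_mem_eq_of_le honto hgs.le
  set x := invFunOn Λ (Ioc 0 e') (Λ g + s * β₀) with hxdef
  refine ⟨hder, ?_⟩
  have hx3 : 0 < x ^ 3 := pow_pos hxmem.1 3
  have key : -2 * V / x ^ 3 - β₀ = β₀ * (-2 / (β₀ * x ^ 3) * V - 1) := by field_simp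
  rw [key, abs_mul, abs_of_pos hβ₀]
  calc β₀ * |-2 / (β₀ * x ^ 3) * V - 1| ≤ β₀ * (3 / 2 * (64 * Cm / (3 * (1 - θ) * bs)) * x) := mul_le_mul_of_nonneg_left hrel hβ₀.le
    _ = 3 / 2 * β₀ * (64 * Cm / (3 * (1 - θ) * bs)) * x := by ring

/-! ## §92 Almost everywhere; asymptotic freedom of the generator -/

/-- **AT ALMOST EVERY COUPLING `Λ′(x) = −(2∕x³)(1 ± κx)`**: for every dynamical Abel function of the flow near the zero pin (strictly antitone on ]0, e′]), for
Lebesgue-a.e. `x ∈ ]0, e′[` there is D with `HasDerivAt Λ D x` and `|(−x³∕2)D − 1| ≤ κx`. [cite: Balaban1987RG1, Thm 2 (0.31) p.259 with (0.18)–(0.20) pp.255–256] -/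
theorem ae_hasDerivAt_dynAbel_oneLoop {B : (ℕ → ℝ) → ℝ} {Cm θ γ bs ta gs e' : ℝ} {t : ℕ → ℝ} {a : ℕ → ℝ} {Λ : ℝ → ℝ}
    (hB : MemoryProfile Cm θ γ B) (hCm : 0 ≤ Cm) (hθ0 : 0 ≤ θ) (hθ1 : θ < 1) (hbs : 0 < bs) (hta : 0 < ta)
    (hts : SeqBox γ t) (htf : MemFlow B gs t) (hprof : ∀ m : ℕ, 1 / ta ^ 2 + bs * (m : ℝ) ≤ 1 / (t m) ^ 2)
    (hΛ : ∀ e ∈ Ioc (0 : ℝ) e', ∀ h : ℕ → ℝ, SeqBox γ h → MemFlow B e h → Tendsto (fun n => 1 / h n ^ 2 - a n) atTop (𝓝 (Λ e)))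
    (hanti : StrictAntiOn Λ (Ioc 0 e'))
    (h2e' : 2 * e' ≤ γ)
    (hs1 : 4 * Cm * e' ≤ bs * (1 - θ))
    (hs2 : e' ^ 2 * (1 / gs ^ 2 + Cm * γ / (1 - θ) ^ 2 + (2 * Cm / ((1 - θ) * bs)) ^ 2) ≤ 3 / 4)
    (hs4 : 64 * Cm * e' ^ 3 ≤ (1 - θ) ^ 2) (hs5 : Cm * (8 * e' ^ 3 + 16 * e' / bs) ≤ (1 - θ) / 4) :
    ∀ᵐ x, x ∈ Ioo (0 : ℝ) e' → ∃ D : ℝ, HasDerivAt Λ D x ∧ |-(x ^ 3) / 2 * D - 1| ≤ 64 * Cm / (3 * (1 - θ) * bs) * x := by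
  filter_upwards [ae_differentiableAt_abel hanti] with x hx hxo
  have hD := (hx hxo).hasDerivAt
  exact ⟨deriv Λ x, hD, (hasDerivAt_dynAbel_oneLoop hB hCm hθ0 hθ1 hbs hta hts htf hprof hΛ h2e' hs1 hs2 hs4 hs5 hxo hD).2.2⟩

/-- **AT ALMOST EVERY SCALE THE RUNNING COUPLING HAS THE ONE-LOOP VELOCITY**: in the setting of `velocity_oneLoop`, for every pin `g ∈ ]0, e′]` and Lebesgue-a.e.
scale `s > 0`, the running coupling has a velocity V at s with `|(−2∕(β₀ φ_s(g)³))·V − 1| ≤ (3∕2)κ·φ_s g` — **`ġ = −(β₀∕2)g³(1 + O(g))` almost everywhere, for every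
memory functional**. [cite: Balaban1987RG1, Thm 2 (0.31) p.259 with (0.18)–(0.20) pp.255–256] -/
theorem ae_velocity_oneLoop {B : (ℕ → ℝ) → ℝ} {Cm θ γ β₀ bs ta gs e' : ℝ} {t : ℕ → ℝ} {a : ℕ → ℝ} {Λ : ℝ → ℝ}
    (hB : MemoryProfile Cm θ γ B) (hCm : 0 ≤ Cm) (hθ0 : 0 ≤ θ) (hθ1 : θ < 1) (hbs : 0 < bs) (hta : 0 < ta)
    (hts : SeqBox γ t) (htf : MemFlow B gs t) (hprof : ∀ m : ℕ, 1 / ta ^ 2 + bs * (m : ℝ) ≤ 1 / (t m) ^ 2)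
    (hΛ : ∀ e ∈ Ioc (0 : ℝ) e', ∀ h : ℕ → ℝ, SeqBox γ h → MemFlow B e h → Tendsto (fun n => 1 / h n ^ 2 - a n) atTop (𝓝 (Λ e)))
    (hanti : StrictAntiOn Λ (Ioc 0 e')) (honto : ∀ y : ℝ, Λ e' ≤ y → ∃ x ∈ Ioc (0 : ℝ) e', Λ x = y) (hβ₀ : 0 < β₀)
    (h2e' : 2 * e' ≤ γ)
    (hs1 : 4 * Cm * e' ≤ bs * (1 - θ))
    (hs2 : e' ^ 2 * (1 / gs ^ 2 + Cm * γ / (1 - θ) ^ 2 + (2 * Cm / ((1 - θ) * bs)) ^ 2) ≤ 3 / 4)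
    (hs4 : 64 * Cm * e' ^ 3 ≤ (1 - θ) ^ 2) (hs5 : Cm * (8 * e' ^ 3 + 16 * e' / bs) ≤ (1 - θ) / 4)
    {g : ℝ} (hg : g ∈ Ioc (0 : ℝ) e') :
    ∀ᵐ s, s ∈ Ioi (0 : ℝ) → ∃ V : ℝ, HasDerivAt (fun σ : ℝ => invFunOn Λ (Ioc 0 e') (Λ g + σ * β₀)) V s ∧ V < 0 ∧
      |-2 / (β₀ * invFunOn Λ (Ioc 0 e') (Λ g + s * β₀) ^ 3) * V - 1| ≤ 3 / 2 * (64 * Cm / (3 * (1 - θ) * bs)) * invFunOn Λ (Ioc 0 e') (Λ g + s * β₀) := by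
  have hbounds := dynAbel_chart_bounds hB hCm hθ0 hθ1 hbs hta hts htf hprof hΛ h2e' hs1 hs2 hs4 hs5
  have he' : e' ∈ Ioc (0 : ℝ) e' := ⟨hg.1.trans_le hg.2, le_rfl⟩
  have hΛg : Λ e' ≤ Λ g := hanti.antitoneOn hg he' hg.2
  filter_upwards [ae_differentiableAt_rg hanti honto hβ₀ hg] with s hs hso
  have hgs : Λ e' < Λ g + s * β₀ := by have := mul_pos (mem_Ioi.1 hso) hβ₀; linarith
  have hV := (hs hso).hasDerivAt
  obtain ⟨-, -, hrel⟩ := velocity_oneLoop hB hCm hθ0 hθ1 hbs hta hts htf hprof hΛ hanti honto hβ₀ h2e' hs1 hs2 hs4 hs5 hgs hV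
  obtain ⟨-, -, hneg⟩ := velocity_bounds hanti honto hβ₀ hbounds hgs hV
  exact ⟨_, hV, hneg, hrel⟩

/-- **THE GENERATOR IS ASYMPTOTICALLY FREE**: for every ε > 0 there is δ > 0 such that for EVERY pin g, EVERY real scale s with `Λ e′ < Λ g + sβ₀` and EVERY velocity V of
`s ↦ φ_s g` at s: if the running coupling `x = φ_s g ≤ δ` then **`|(−2∕(β₀x³))·V − 1| ≤ ε`** — `V ∼ −(β₀∕2)x³` as the running coupling tends to zero, uniformly, in the
only sense available without differentiating B. [cite: Balaban1987RG1, Thm 2 (0.31) p.259 with (0.18)–(0.20) pp.255–256] -/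
theorem generator_asymptoticallyFree {B : (ℕ → ℝ) → ℝ} {Cm θ γ β₀ bs ta gs e' : ℝ} {t : ℕ → ℝ} {a : ℕ → ℝ} {Λ : ℝ → ℝ}
    (hB : MemoryProfile Cm θ γ B) (hCm : 0 ≤ Cm) (hθ0 : 0 ≤ θ) (hθ1 : θ < 1) (hbs : 0 < bs) (hta : 0 < ta)
    (hts : SeqBox γ t) (htf : MemFlow B gs t) (hprof : ∀ m : ℕ, 1 / ta ^ 2 + bs * (m : ℝ) ≤ 1 / (t m) ^ 2)
    (hΛ : ∀ e ∈ Ioc (0 : ℝ) e', ∀ h : ℕ → ℝ, SeqBox γ h → MemFlow B e h → Tendsto (fun n => 1 / h n ^ 2 - a n) atTop (𝓝 (Λ e)))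
    (hanti : StrictAntiOn Λ (Ioc 0 e')) (honto : ∀ y : ℝ, Λ e' ≤ y → ∃ x ∈ Ioc (0 : ℝ) e', Λ x = y) (hβ₀ : 0 < β₀)
    (h2e' : 2 * e' ≤ γ)
    (hs1 : 4 * Cm * e' ≤ bs * (1 - θ))
    (hs2 : e' ^ 2 * (1 / gs ^ 2 + Cm * γ / (1 - θ) ^ 2 + (2 * Cm / ((1 - θ) * bs)) ^ 2) ≤ 3 / 4)
    (hs4 : 64 * Cm * e' ^ 3 ≤ (1 - θ) ^ 2) (hs5 : Cm * (8 * e' ^ 3 + 16 * e' / bs) ≤ (1 - θ) / 4) :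
    ∀ ε : ℝ, 0 < ε → ∃ δ > 0, ∀ g s V : ℝ, Λ e' < Λ g + s * β₀ → invFunOn Λ (Ioc 0 e') (Λ g + s * β₀) ≤ δ →
      HasDerivAt (fun σ : ℝ => invFunOn Λ (Ioc 0 e') (Λ g + σ * β₀)) V s →
      |-2 / (β₀ * invFunOn Λ (Ioc 0 e') (Λ g + s * β₀) ^ 3) * V - 1| ≤ ε := by
  intro ε hε
  set κ := 64 * Cm / (3 * (1 - θ) * bs) with hκdef
  have h1θ : 0 < 1 - θ := by linarith
  have hκ0 : 0 ≤ κ := by positivity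
  refine ⟨ε / (3 / 2 * κ + 1), div_pos hε (by positivity), fun g s V hgs hδ hV => ?_⟩
  obtain ⟨-, -, hrel⟩ := velocity_oneLoop hB hCm hθ0 hθ1 hbs hta hts htf hprof hΛ hanti honto hβ₀ h2e' hs1 hs2 hs4 hs5 hgs hV
  obtain ⟨hxmem, -⟩ := rg_mem_eq_of_le honto hgs.le
  set x := invFunOn Λ (Ioc 0 e') (Λ g + s * β₀) with hxdef
  calc |-2 / (β₀ * x ^ 3) * V - 1| ≤ 3 / 2 * κ * x := hrel
    _ ≤ 3 / 2 * κ * (ε / (3 / 2 * κ + 1)) := mul_le_mul_of_nonneg_left hδ (by positivity)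
    _ ≤ ε := by
        rw [mul_div_assoc', div_le_iff₀ (by positivity)]
        nlinarith

end

end Summit.QuantumFields.BalabanUV.Beta.EriceFlowEnclosureB12AsPrintedHistoryContagionShiftFlowZeroSemigroupGellMannLowOneLoop
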